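import Summits.CriticalPhenomena.PercolationContinuityZ3.Theses.PercTiltedBlockers
import Summits.CriticalPhenomena.PercolationContinuityZ3.Theses.PercAnnulusCrossing
import Summits.CriticalPhenomena.PercolationContinuityZ3.Theorems.PercTiltedBlockersCubeBlockingSeedRungOfTallTilt
import Summits.CriticalPhenomena.PercolationContinuityZ3.Theorems.PercTiltedBlockersCubeBlockingSeedLadder
import Summits.CriticalPhenomena.PercolationContinuityZ3.Theorems.PercTiltedBlockersCubeBlockingSeedTallSeedOfFlatAnnulusCrossing
import Summits.CriticalPhenomena.PercolationContinuityZ3.Theorems.PercTiltedBlockersCubeBlockingSeedTallTiltOfWideSeeds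
import Summits.CriticalPhenomena.PercolationContinuityZ3.Theorems.PercTiltedBlockersCubeBlockingSeedOfHeightHalving12
import Summits.CriticalPhenomena.PercolationContinuityZ3.Theorems.PercTiltedBlockersCubeBlockingSeedOfHalvingRung

/-!
# Birth skeleton for the crux `CubeBlockingSeed` (stmt-CriticalPhenomena-1141) — lead c1 RESHAPE r5 (2026-08-17, end of cycle 2)
r5 = r4 with the comparison stub put back in its WEAKEST, certified-consistent form: the registered open stubs are now
`stub_tallSeed` (unchanged; ⟸ `FlatAnnulusCrossing` 6699, p149647) and `stub_halvingRung` (the ORIGINAL birth stub, inf-form: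
`∀ k ≥ 1, SeedAt (2k) → SeedAt k`; certified ⟸ `CritAnnulusNonCrossing` 0846 and ⟸ the bounded-aspect height halving `HeightHalving12`,
p154818 / p154610). `stub_tallTilt` (r4's comparison stub, a g-form single-box tilt comparison on the tall family) is DEMOTED to a
landed SUFFICIENT CONDITION for the rung (`halvingRung_of_tallTilt`, via `stub_rungOfTallTilt` p147062) — it is stronger than the rung,
equally open (Benjamini–Kalai class), and passed its kill test (tilt ratios scale-invariant to m = 24, KILLSTATS.md), so nothing is lost:
a proof of TallTilt, of HeightHalving12, or of the rung itself each closes the comparison side. Why the weaker stub: fewer quantifiers, the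
exact statement the ladder consumes, and the only form whose consistency with X_B is kernel-certified. Composition unchanged in spirit:
`CubeBlockingSeed_of : Registered.stub_tallSeed → Registered.stub_halvingRung → CubeBlockingSeed` (the r3 ladder). Below, the r4 text.

# (r4) Birth skeleton (BC3) for the crux `CubeBlockingSeed` (stmt-CriticalPhenomena-1141) — lead 0 reshape r4 (2026-08-17, end of cycle 1):
registered stub signatures inlined in tree vocabulary (landable from `Theorems/`); STUB 2 `halvingRung` SPLIT
(after the wave-1 worker's `stub-misstated`) into `stub_tallTilt` (OPEN: one single-box tilt comparison on the tall
family h = 4km, L, M ∈ [2m, 5m], δ = m) + `stub_rungOfTallTilt` (LANDED p147062,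
`Theorems/PercTiltedBlockersCubeBlockingSeedRungOfTallTilt.lean`: tall tilt comparison ⟹ halving rung, via
`tiltSquaring_proof` + axis swap + height monotonicity + a finite floor for n ≤ 11); the glue `stub_ladder`
(tallSeed → halvingRung → crux) LANDED p149603 (`Theorems/PercTiltedBlockersCubeBlockingSeedLadder.lean`); the load-bearing
`stub_tallSeed` is CERTIFIED to follow from the sibling crux `PercDivergentSlabLadder.FlatAnnulusCrossing` (stmt-6699)
— `stub_tallSeedOfFlatAnnulusCrossing`, LANDED p149647 — so the crux follows from 6699 ∧ `stub_tallTilt` alone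
(`seedAt_one_of_flatAnnulusCrossing_of_tallTilt` below; importable twin LANDING as `…SecondEntrance.lean`); and `stub_tallTilt` is
CERTIFIED consistent with the route — `stub_tallTiltOfWideSeeds` (wave-2 worker, LANDED p150740): flat wide seeds (the conclusion of
`WideBoxFromTilt`, hence `TiltComparison ∧ CubeBlockingSeed`) give TallTilt with a constant g (staircase of three seals + Harris)

Route `route-CriticalPhenomena-PercTiltedBlockers` (rank 3; shared verbatim with
`route-CriticalPhenomena-PercAnnulusCrossing`, rank 4), sub-problem `PercolationContinuityZ3`,
crux decl `Summit.CriticalPhenomena.PercolationContinuityZ3.Theses.PercTiltedBlockers.CubeBlockingSeed`: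
there is `c > 0` with `P_{p_c}(no open path inside [0,n]³ from the face x₀ = 0 to the face x₀ = n) ≥ c`
for all `n ≥ 1` — the "bounded away from 1" half of the Borgs–Chayes–Kesten–Spencer hyperscaling
postulate for the cube of `ℤ³` (open in print; false for `d > 6`, barrier `SpanningClustersAboveSix`).

THE LINE (aspect-ratio ladder on the TALL family). Write `R(h; L, M) = [0,h] × [0,L] × [0,M]`
(`x₀` = height = the blocked direction), `β_p(h; L, M) := P_p(R(h;L,M) blocked)` (`blockP`) and
`SeedAt k :≡ ∃ c > 0, ∀ n ≥ 1, β_{p_c}(k·n; n, n) ≥ c` (the boxes of aspect ratio `k` — height `k n`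
over an `n × n` cross-section — are blocked with probability bounded below). The crux is LITERALLY
`SeedAt 1` (`seedAt_one_iff`; `cubeBlockingSeed_iff` is `Iff.rfl`). Taller boxes are easier to block,
so `SeedAt k` gets WEAKER as `k` grows; the weakest members of the family are the tall tubes. Two
registered stubs:

* STUB 1 `stub_tallSeed` (XL, OPEN — the `d = 3`-specific input): `∃ k ≥ 1, SeedAt k` — SOME tall
  tube `[0,kn] × [0,n]²` is blocked lengthwise at `p_c(ℤ³)` with probability `≥ c(k) > 0` for all `n`.
  Equivalently: the cluster of the bottom face inside the tube of cross-section `n` dies before height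
  `k n` with probability bounded below — "the critical tube of width `n` has correlation length `O(n)`",
  the finite-size (`ν`-type) content of hyperscaling in its weakest shape. For each FIXED `n` it is
  trivial (`β(h; n, n) → 1` as `h → ∞`, the tube being quasi-one-dimensional; and `β > 0` always since
  `p_c < 1`); the content is `k` independent of `n`. It is false for every fixed `k` in `d > 6` under
  `η = 0` (≈ `n^{d-6}` spanning clusters of any fixed-aspect box, Aizenman 1997 Thm 4), so a proof must
  use `d = 3` exactly as for the crux; implied by the crux (`k = 1`, `tallSeed_of`).
* STUB 2 `stub_halvingRung` (XL, OPEN — blocker-RSW technology, one rung, all tall aspect ratios):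
  `∀ k ≥ 1, SeedAt (2k) → SeedAt k` — if the boxes of aspect `2k` are blocked with probability bounded
  below then so are the boxes of aspect `k` (equivalently, at height `2k·n`: doubling the cross-section
  `n × n ↦ 2n × 2n` keeps the blocking probability positive). This is the Benjamini–Kalai
  "RSW for plaquettes" problem restricted to the tall family and to the `inf`-over-`n` form; on this
  route it is expected to come from a tilt comparison on tall shapes + the PROVED squaring step
  (`TiltSquaring`, `Theorems.tiltSquaring_proof`) + height monotonicity, exactly as `WideBoxFromTilt`
  does on the flat family. Implied by the crux given height monotonicity (`halvingRung_of`).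

Composition (kernel-checked, no `sorry`): `CubeBlockingSeed_of : stub_tallSeed → stub_halvingRung →
CubeBlockingSeed` (the `PercTiltedBlockers` decl) and `CubeBlockingSeedShared_of` (the same two stubs →
the item's primary decl `PercAnnulusCrossing.CubeBlockingSeed`, which has the identical body:
`cubeBlockingSeed_shared_iff` is `Iff.rfl`) — lift the seed from aspect `k₀` to aspect `2^{k₀} ≥ k₀`
by the PROVED height monotonicity `blockP_mono_height` (a lattice open path from the bottom to the
top of the taller box is clipped at the lower height, `exists_openConnIn_le_level`; stated for
probabilities because the raw events are not nested — configurations with non-lattice "edges", the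
`not_TiltGluing` phenomenon — and reduced to lattice configurations by
`DCT16.real_mono_of_forall_subset_edgeSet`), then descend `2^{j+1} ↦ 2^j` by STUB 2 down to `SeedAt 1`,
which is the crux.

DISPROOF USED: none exists for this crux (`ledger crux ls stmt-CriticalPhenomena-1141`: no workfiles,
no `Disproof.lean`, no landed Negative lemma, 2026-08-17). Negatives index of the summit (11 entries):
only `not_TiltGluing` concerns these boxes, and it kills RAW-configuration inclusions — honoured here by
stating every comparison for `P_p`-probabilities and proving the one used via the a.e. lattice
reduction. The refuted strengthenings in `Theorems/SubpolynomialBlocking/Negative/Strengthenings.lean`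
concern annulus blocking `u_n`, not face-to-face box blocking. Both stubs are consequences of the crux
(`tallSeed_of`, `halvingRung_of` below), hence refutable only together with the crux (kill criterion of
both routes: critical cube crossing probability `→ 1` along a subsequence).
-/

noncomputable section

namespace Summit.CriticalPhenomena.PercolationContinuityZ3.Cruxes.CubeBlockingSeed.Birth

open MeasureTheory Filter Literature.Probability.Percolation Literature.Probability.LatticeModels
open Summit.CriticalPhenomena.PercolationContinuityZ3.Theses.PercTiltedBlockers (CubeBlockingSeed)

/-! ## Objects of the line -/

/-- `Blocked(h; L, M)`: no open path inside `R(h;L,M) = [0,h]×[0,L]×[0,M]` (an order box of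
`Site 3 = Fin 3 → ℤ`, `x 0` = height) from the face `x₀ = 0` to the face `x₀ = h` — verbatim the
event of the crux at `h = L = M = n`. -/
def blocked (h L M : ℕ) : Set (BondConfig (Site 3)) :=
  {ω | ¬ ∃ x ∈ Finset.Icc (0 : Site 3) ![(h : ℤ), L, M], ∃ y ∈ Finset.Icc (0 : Site 3) ![(h : ℤ), L, M],
    x 0 = 0 ∧ y 0 = h ∧ ω ∈ openConnIn ↑(Finset.Icc (0 : Site 3) ![(h : ℤ), L, M]) x y}

/-- `β_p(h; L, M) := P_p(Blocked(h; L, M))`. -/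
def blockP (p : unitInterval) (h L M : ℕ) : ℝ := (bondPercolation (zdGraph 3) p).real (blocked h L M)

/-- `SeedAt k`: the boxes of aspect ratio `k` (height `k·n` over an `n × n` cross-section) are
blocked at `p_c(ℤ³)` with probability bounded away from `0`, uniformly in `n ≥ 1`. -/
def SeedAt (k : ℕ) : Prop :=
  ∃ c : ℝ, 0 < c ∧ ∀ n : ℕ, 1 ≤ n → c ≤ blockP (criticalProbI 3) (k * n) n n

/-- The crux, read through `blockP` (definitional). -/
theorem cubeBlockingSeed_iff :
    CubeBlockingSeed ↔ ∃ c : ℝ, 0 < c ∧ ∀ n : ℕ, 1 ≤ n → c ≤ blockP (criticalProbI 3) n n n :=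
  Iff.rfl

/-- The crux is literally `SeedAt 1`. -/
theorem seedAt_one_iff : SeedAt 1 ↔ CubeBlockingSeed := by
  have e : SeedAt 1 ↔ ∃ c : ℝ, 0 < c ∧ ∀ n : ℕ, 1 ≤ n → c ≤ blockP (criticalProbI 3) n n n := by
    simp only [SeedAt, one_mul]
  exact e.trans cubeBlockingSeed_iff.symm

/-! ## The stub statements (readable names; the registered texts below are these, by `Iff.rfl`) -/

/-- STUB 1 statement — the TUBE SEED: some tall shape of fixed aspect ratio is blocked at `p_c`
with probability bounded below, uniformly in the scale. -/
def TallSeed : Prop := ∃ k : ℕ, 1 ≤ k ∧ SeedAt k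

/-- The HALVING RUNG of blocker-RSW on the tall family (since wave 1 no longer a stub — it is DERIVED
from `TallTilt` by the landed `stub_rungOfTallTilt`, see `halvingRung_of_tallTilt`). -/
def HalvingRung : Prop := ∀ k : ℕ, 1 ≤ k → SeedAt (2 * k) → SeedAt k

/-- `Tilt(R(h;L,M); δ, a)` at `p_c`: probability that NO open path inside `R(h;L,M)` joins
`Src = {x₀ = 0} ∪ {x₁ = L, x₀ < a}` to `Tgt = {x₀ = h} ∪ {x₁ = δ, x₀ ≥ a}` (the route's tilt datum, as in
`Theses.PercTiltedBlockers.TiltComparison` / `TiltSquaring`). -/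
def tiltP (h L M δ a : ℕ) : ℝ :=
  (bondPercolation (zdGraph 3) (criticalProbI 3)).real
    {ω | ¬ ∃ x ∈ Finset.Icc (0 : Site 3) ![(h : ℤ), L, M], ∃ y ∈ Finset.Icc (0 : Site 3) ![(h : ℤ), L, M],
      (x 0 = 0 ∨ (x 1 = L ∧ x 0 < a)) ∧ (y 0 = h ∨ (y 1 = δ ∧ (a : ℤ) ≤ y 0)) ∧
        ω ∈ openConnIn ↑(Finset.Icc (0 : Site 3) ![(h : ℤ), L, M]) x y}

/-- STUB 2′ statement — TALL TILT COMPARISON (wave-1 reshape of the rung): for every aspect parameter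
`k ≥ 1` there is one monotone `g > 0` on `(0,∞)` such that on the tall family `R(4km; L, M)`,
`L, M ∈ [2m, 5m]`, some level `a` has `P(Tilt(R; m, a)) ≥ g(P(R blocked))` — the exact analogue, on tall
shapes with `δ = m ≤ L/2` (never degenerate), of the route's rank-2 crux `TiltComparison` (flat family
`h = 4m ≤ L, M ≤ 24m`). -/
def TallTilt : Prop :=
  ∀ k : ℕ, 1 ≤ k → ∃ g : ℝ → ℝ, Monotone g ∧ (∀ s, 0 < s → 0 < g s) ∧
    ∀ m L M : ℕ, 1 ≤ m → 2 * m ≤ L → L ≤ 5 * m → 2 * m ≤ M → M ≤ 5 * m → ∃ a : ℕ,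
      g (blockP (criticalProbI 3) (4 * k * m) L M) ≤ tiltP (4 * k * m) L M m a

/-! ## Registered stubs (signatures inlined in tree vocabulary — `Theorems/` files cannot import this
Cruxes module, so a stub file proves literally the text below, in
`namespace Summit.CriticalPhenomena.PercolationContinuityZ3.Theorems.CubeBlockingSeed`, with
`open Literature.Probability.Percolation Literature.Probability.LatticeModels`; the `stub_*_iff` lemmas
certify by `Iff.rfl` that the inlined texts ARE the named statements above). The ONLY `sorry`s of this file
are `stub_tallSeed` and `stub_halvingRung` (r5). -/

/-- **STUB 1 `stub_tallSeed`** (XL, OPEN — load-bearing, `d = 3`-specific; = `TallSeed` by `stub_tallSeed_iff`; held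
by the lead): `∃ k ≥ 1, ∃ c > 0, ∀ n ≥ 1, P_{p_c}(no open path inside [0,kn]×[0,n]² from {x₀ = 0} to {x₀ = kn}) ≥ c`.
Why plausibly true: at criticality the only length scale is `n`, so the tube of cross-section `n` has
correlation length `≍ n` and the bottom-face cluster dies within height `O(n)` with positive probability
(numerics: the CUBE is blocked with probability `0.31 … 0.68` for `n = 1 … 32`, plateau `0.69–0.72` for
`96 ≤ n ≤ 256`, MC evidence on items 1141/4446; tube seeds `k = 1, 2, 4` up to `n = 48`: job j023618 on the item).
Why it might fail: exactly like the crux — a proliferating-spanning-clusters world in which every fixed-aspect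
box is crossed w.h.p. (proved for `d > 6` under `η = 0`, Aizenman 1997 Thm 4); no tool bounds the critical
tube's correlation length in `d = 3` uniformly in `n` (`p_c(ℤ³)` is subcritical for every slab/tube of width `n`,
DCST 2016 / Grimmett–Marstrand, but with no rate in `n`). It is a CONSEQUENCE of the crux (`tallSeed_of`).
Entry points: Borgs–Chayes–Kesten–Spencer 1999 §1; Hutchcroft 2025 (arXiv:2508.18808) p.45; Grimmett 1999 §7. -/
theorem stub_tallSeed :
    ∃ k : ℕ, 1 ≤ k ∧ ∃ c : ℝ, 0 < c ∧ ∀ n : ℕ, 1 ≤ n →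
      c ≤ (bondPercolation (zdGraph 3) (criticalProbI 3)).real
          {ω | ¬ ∃ x ∈ Finset.Icc (0 : Site 3) ![((k * n : ℕ) : ℤ), n, n],
            ∃ y ∈ Finset.Icc (0 : Site 3) ![((k * n : ℕ) : ℤ), n, n],
              x 0 = 0 ∧ y 0 = ((k * n : ℕ) : ℤ) ∧
                ω ∈ openConnIn ↑(Finset.Icc (0 : Site 3) ![((k * n : ℕ) : ℤ), n, n]) x y} := by
  sorry

/-- **STUB 2 `stub_halvingRung`** (XL, OPEN — r5: the comparison input in its weakest form; = `HalvingRung` by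
`stub_halvingRung_iff`): `∀ k ≥ 1, SeedAt (2k) → SeedAt k` — if the tubes of aspect `2k` are blocked at `p_c(ℤ³)` with probability
bounded below uniformly in the scale, so are the tubes of aspect `k` (equivalently, at height `2kn`, doubling the cross-section
`n × n ↦ 2n × 2n` keeps blocking positive). Fixed-factor RSW in the hard direction on TALL tubes, inf-over-`n` form: the
Benjamini–Kalai "RSW for plaquettes" problem (BenjaminiKalai2018 p.71) restricted to the tall family; OPEN. Certified: it is a
CONSEQUENCE of the crux (`halvingRung_of`), of `X_B` (`Theorems.CubeBlockingSeed.halvingRung_of_critAnnulusNonCrossing`, p154818),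
of the bounded-aspect height halving `HeightHalving12` (`…halvingRung_of_heightHalving12`, p154610) and of r4's tall tilt comparison
(`halvingRung_of_tallTilt`, p147062); numerically the direct height-halving ratios on tubes are stable to `n = 64` (KILLSTATS.md).
Why it might fail: only together with every RSW-type comparison at `p_c(ℤ³)` (a "tall tubes behave like `d > 6` while cubes do not"
world); the wave-1 worker's `stub-misstated` on this text meant "not derivable from tree tools", not "false". -/
theorem stub_halvingRung :
    ∀ k : ℕ, 1 ≤ k →
      (∃ c : ℝ, 0 < c ∧ ∀ n : ℕ, 1 ≤ n →
        c ≤ (bondPercolation (zdGraph 3) (criticalProbI 3)).real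
          {ω | ¬ ∃ x ∈ Finset.Icc (0 : Site 3) ![((2 * k * n : ℕ) : ℤ), n, n],
            ∃ y ∈ Finset.Icc (0 : Site 3) ![((2 * k * n : ℕ) : ℤ), n, n],
              x 0 = 0 ∧ y 0 = ((2 * k * n : ℕ) : ℤ) ∧
                ω ∈ openConnIn ↑(Finset.Icc (0 : Site 3) ![((2 * k * n : ℕ) : ℤ), n, n]) x y}) →
      ∃ c : ℝ, 0 < c ∧ ∀ n : ℕ, 1 ≤ n →
        c ≤ (bondPercolation (zdGraph 3) (criticalProbI 3)).real
          {ω | ¬ ∃ x ∈ Finset.Icc (0 : Site 3) ![((k * n : ℕ) : ℤ), n, n],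
            ∃ y ∈ Finset.Icc (0 : Site 3) ![((k * n : ℕ) : ℤ), n, n],
              x 0 = 0 ∧ y 0 = ((k * n : ℕ) : ℤ) ∧
                ω ∈ openConnIn ↑(Finset.Icc (0 : Site 3) ![((k * n : ℕ) : ℤ), n, n]) x y} := by
  sorry

/-! ### r4's tall tilt comparison, now a landed SUFFICIENT condition for STUB 2 (no `sorry`: it enters only as the
hypothesis `TallTilt` / `Registered.stub_tallTilt` of `halvingRung_of_tallTilt`). Its r4 docstring, for the record:
STUB 2′ `stub_tallTilt` (XL, OPEN — blocker-RSW input, ONE single-box statement per `k`): for every `k ≥ 1`, on the tall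
family `R(4km; L, M)`, `L, M ∈ [2m, 5m]`, at `p_c(ℤ³)`: `∃ a, P(Tilt(R; m, a)) ≥ g_k(P(R blocked))` with `g_k` monotone,
`> 0` on `(0,∞)`; Benjamini–Kalai class; consistent with `d > 6`; certified ⟸ `TiltComparison ∧ CubeBlockingSeed` (p150740);
kill test passed (KILLSTATS.md: max_a P(Tilt_a)/β scale-invariant on every consumed shape to m = 24). -/

/-- **STUB 2″ `stub_rungOfTallTilt`** (L — LANDED p147062 by the wave-1 stub-worker,
`Theorems/PercTiltedBlockersCubeBlockingSeedRungOfTallTilt.lean`): `∀ k ≥ 1, TallTilt(k) → SeedAt (2k) → SeedAt k`.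
Proof: at height `4km`, walk the cross-section `2m → 5m` at `M = 2m` by tilt squaring with `δ = m`
(`tiltSquaring_proof`), swap the horizontal axes, walk again at `M = 5m` (six squarings, `c_{j+1} = g(c_j)²`);
read `n ≥ 12` through `m = ⌊n/4⌋` with height monotonicity / width anti-monotonicity, and the finitely many
`n ≤ 11` through the floor `β > 0` (`p_c(ℤ³) < 1`). -/
theorem stub_rungOfTallTilt :
    ∀ k : ℕ, 1 ≤ k →
      (∃ g : ℝ → ℝ, Monotone g ∧ (∀ s, 0 < s → 0 < g s) ∧
        ∀ m L M : ℕ, 1 ≤ m → 2 * m ≤ L → L ≤ 5 * m → 2 * m ≤ M → M ≤ 5 * m → ∃ a : ℕ,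
          g ((bondPercolation (zdGraph 3) (criticalProbI 3)).real
              {ω | ¬ ∃ x ∈ Finset.Icc (0 : Site 3) ![((4 * k * m : ℕ) : ℤ), L, M],
                ∃ y ∈ Finset.Icc (0 : Site 3) ![((4 * k * m : ℕ) : ℤ), L, M],
                  x 0 = 0 ∧ y 0 = ((4 * k * m : ℕ) : ℤ) ∧
                    ω ∈ openConnIn ↑(Finset.Icc (0 : Site 3) ![((4 * k * m : ℕ) : ℤ), L, M]) x y}) ≤
          (bondPercolation (zdGraph 3) (criticalProbI 3)).real
            {ω | ¬ ∃ x ∈ Finset.Icc (0 : Site 3) ![((4 * k * m : ℕ) : ℤ), L, M],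
              ∃ y ∈ Finset.Icc (0 : Site 3) ![((4 * k * m : ℕ) : ℤ), L, M],
                (x 0 = 0 ∨ (x 1 = L ∧ x 0 < a)) ∧
                  (y 0 = ((4 * k * m : ℕ) : ℤ) ∨ (y 1 = m ∧ (a : ℤ) ≤ y 0)) ∧
                  ω ∈ openConnIn ↑(Finset.Icc (0 : Site 3) ![((4 * k * m : ℕ) : ℤ), L, M]) x y}) →
      (∃ c : ℝ, 0 < c ∧ ∀ n : ℕ, 1 ≤ n →
        c ≤ (bondPercolation (zdGraph 3) (criticalProbI 3)).real
          {ω | ¬ ∃ x ∈ Finset.Icc (0 : Site 3) ![((2 * k * n : ℕ) : ℤ), n, n],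
            ∃ y ∈ Finset.Icc (0 : Site 3) ![((2 * k * n : ℕ) : ℤ), n, n],
              x 0 = 0 ∧ y 0 = ((2 * k * n : ℕ) : ℤ) ∧
                ω ∈ openConnIn ↑(Finset.Icc (0 : Site 3) ![((2 * k * n : ℕ) : ℤ), n, n]) x y}) →
      ∃ c : ℝ, 0 < c ∧ ∀ n : ℕ, 1 ≤ n →
        c ≤ (bondPercolation (zdGraph 3) (criticalProbI 3)).real
          {ω | ¬ ∃ x ∈ Finset.Icc (0 : Site 3) ![((k * n : ℕ) : ℤ), n, n],
            ∃ y ∈ Finset.Icc (0 : Site 3) ![((k * n : ℕ) : ℤ), n, n],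
              x 0 = 0 ∧ y 0 = ((k * n : ℕ) : ℤ) ∧
                ω ∈ openConnIn ↑(Finset.Icc (0 : Site 3) ![((k * n : ℕ) : ℤ), n, n]) x y} :=
  Theorems.CubeBlockingSeed.stub_rungOfTallTilt

/-! ### Name-keyed aliases of the registered signatures -/
namespace Registered

/-- Registered text of `stub_tallSeed`, as a `Prop`. -/
abbrev stub_tallSeed : Prop :=
  ∃ k : ℕ, 1 ≤ k ∧ ∃ c : ℝ, 0 < c ∧ ∀ n : ℕ, 1 ≤ n →
  c ≤ (bondPercolation (zdGraph 3) (criticalProbI 3)).real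
      {ω | ¬ ∃ x ∈ Finset.Icc (0 : Site 3) ![((k * n : ℕ) : ℤ), n, n],
        ∃ y ∈ Finset.Icc (0 : Site 3) ![((k * n : ℕ) : ℤ), n, n],
          x 0 = 0 ∧ y 0 = ((k * n : ℕ) : ℤ) ∧
            ω ∈ openConnIn ↑(Finset.Icc (0 : Site 3) ![((k * n : ℕ) : ℤ), n, n]) x y}

/-- Registered text of `stub_halvingRung` (r5), as a `Prop`. -/
abbrev stub_halvingRung : Prop :=
  ∀ k : ℕ, 1 ≤ k →
  (∃ c : ℝ, 0 < c ∧ ∀ n : ℕ, 1 ≤ n →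
    c ≤ (bondPercolation (zdGraph 3) (criticalProbI 3)).real
      {ω | ¬ ∃ x ∈ Finset.Icc (0 : Site 3) ![((2 * k * n : ℕ) : ℤ), n, n],
        ∃ y ∈ Finset.Icc (0 : Site 3) ![((2 * k * n : ℕ) : ℤ), n, n],
          x 0 = 0 ∧ y 0 = ((2 * k * n : ℕ) : ℤ) ∧
            ω ∈ openConnIn ↑(Finset.Icc (0 : Site 3) ![((2 * k * n : ℕ) : ℤ), n, n]) x y}) →
  ∃ c : ℝ, 0 < c ∧ ∀ n : ℕ, 1 ≤ n →
    c ≤ (bondPercolation (zdGraph 3) (criticalProbI 3)).real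
      {ω | ¬ ∃ x ∈ Finset.Icc (0 : Site 3) ![((k * n : ℕ) : ℤ), n, n],
        ∃ y ∈ Finset.Icc (0 : Site 3) ![((k * n : ℕ) : ℤ), n, n],
          x 0 = 0 ∧ y 0 = ((k * n : ℕ) : ℤ) ∧
            ω ∈ openConnIn ↑(Finset.Icc (0 : Site 3) ![((k * n : ℕ) : ℤ), n, n]) x y}

/-- Registered text of `stub_tallTilt` (r4; in r5 a hypothesis only), as a `Prop`. -/
abbrev stub_tallTilt : Prop :=
  ∀ k : ℕ, 1 ≤ k →
  ∃ g : ℝ → ℝ, Monotone g ∧ (∀ s, 0 < s → 0 < g s) ∧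
    ∀ m L M : ℕ, 1 ≤ m → 2 * m ≤ L → L ≤ 5 * m → 2 * m ≤ M → M ≤ 5 * m → ∃ a : ℕ,
      g ((bondPercolation (zdGraph 3) (criticalProbI 3)).real
          {ω | ¬ ∃ x ∈ Finset.Icc (0 : Site 3) ![((4 * k * m : ℕ) : ℤ), L, M],
            ∃ y ∈ Finset.Icc (0 : Site 3) ![((4 * k * m : ℕ) : ℤ), L, M],
              x 0 = 0 ∧ y 0 = ((4 * k * m : ℕ) : ℤ) ∧
                ω ∈ openConnIn ↑(Finset.Icc (0 : Site 3) ![((4 * k * m : ℕ) : ℤ), L, M]) x y}) ≤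
      (bondPercolation (zdGraph 3) (criticalProbI 3)).real
        {ω | ¬ ∃ x ∈ Finset.Icc (0 : Site 3) ![((4 * k * m : ℕ) : ℤ), L, M],
          ∃ y ∈ Finset.Icc (0 : Site 3) ![((4 * k * m : ℕ) : ℤ), L, M],
            (x 0 = 0 ∨ (x 1 = L ∧ x 0 < a)) ∧
              (y 0 = ((4 * k * m : ℕ) : ℤ) ∨ (y 1 = m ∧ (a : ℤ) ≤ y 0)) ∧
              ω ∈ openConnIn ↑(Finset.Icc (0 : Site 3) ![((4 * k * m : ℕ) : ℤ), L, M]) x y}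

/-- Registered text of `stub_rungOfTallTilt`, as a `Prop`. -/
abbrev stub_rungOfTallTilt : Prop :=
  ∀ k : ℕ, 1 ≤ k →
  (∃ g : ℝ → ℝ, Monotone g ∧ (∀ s, 0 < s → 0 < g s) ∧
    ∀ m L M : ℕ, 1 ≤ m → 2 * m ≤ L → L ≤ 5 * m → 2 * m ≤ M → M ≤ 5 * m → ∃ a : ℕ,
      g ((bondPercolation (zdGraph 3) (criticalProbI 3)).real
          {ω | ¬ ∃ x ∈ Finset.Icc (0 : Site 3) ![((4 * k * m : ℕ) : ℤ), L, M],
            ∃ y ∈ Finset.Icc (0 : Site 3) ![((4 * k * m : ℕ) : ℤ), L, M],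
              x 0 = 0 ∧ y 0 = ((4 * k * m : ℕ) : ℤ) ∧
                ω ∈ openConnIn ↑(Finset.Icc (0 : Site 3) ![((4 * k * m : ℕ) : ℤ), L, M]) x y}) ≤
      (bondPercolation (zdGraph 3) (criticalProbI 3)).real
        {ω | ¬ ∃ x ∈ Finset.Icc (0 : Site 3) ![((4 * k * m : ℕ) : ℤ), L, M],
          ∃ y ∈ Finset.Icc (0 : Site 3) ![((4 * k * m : ℕ) : ℤ), L, M],
            (x 0 = 0 ∨ (x 1 = L ∧ x 0 < a)) ∧
              (y 0 = ((4 * k * m : ℕ) : ℤ) ∨ (y 1 = m ∧ (a : ℤ) ≤ y 0)) ∧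
              ω ∈ openConnIn ↑(Finset.Icc (0 : Site 3) ![((4 * k * m : ℕ) : ℤ), L, M]) x y}) →
  (∃ c : ℝ, 0 < c ∧ ∀ n : ℕ, 1 ≤ n →
    c ≤ (bondPercolation (zdGraph 3) (criticalProbI 3)).real
      {ω | ¬ ∃ x ∈ Finset.Icc (0 : Site 3) ![((2 * k * n : ℕ) : ℤ), n, n],
        ∃ y ∈ Finset.Icc (0 : Site 3) ![((2 * k * n : ℕ) : ℤ), n, n],
          x 0 = 0 ∧ y 0 = ((2 * k * n : ℕ) : ℤ) ∧
            ω ∈ openConnIn ↑(Finset.Icc (0 : Site 3) ![((2 * k * n : ℕ) : ℤ), n, n]) x y}) →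
  ∃ c : ℝ, 0 < c ∧ ∀ n : ℕ, 1 ≤ n →
    c ≤ (bondPercolation (zdGraph 3) (criticalProbI 3)).real
      {ω | ¬ ∃ x ∈ Finset.Icc (0 : Site 3) ![((k * n : ℕ) : ℤ), n, n],
        ∃ y ∈ Finset.Icc (0 : Site 3) ![((k * n : ℕ) : ℤ), n, n],
          x 0 = 0 ∧ y 0 = ((k * n : ℕ) : ℤ) ∧
            ω ∈ openConnIn ↑(Finset.Icc (0 : Site 3) ![((k * n : ℕ) : ℤ), n, n]) x y}

end Registered

/-- The registered text of STUB 1 is `TallSeed` (definitional). -/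
theorem stub_tallSeed_iff : Registered.stub_tallSeed ↔ TallSeed := Iff.rfl

/-- The registered text of STUB 2 (r5) is `HalvingRung` (definitional). -/
theorem stub_halvingRung_iff : Registered.stub_halvingRung ↔ HalvingRung := Iff.rfl

/-- The registered text of r4's STUB 2′ is `TallTilt` (definitional). -/
theorem stub_tallTilt_iff : Registered.stub_tallTilt ↔ TallTilt := Iff.rfl

/-- The registered text of STUB 2″, read through `blockP` / `tiltP` / `SeedAt` (definitional). -/
theorem stub_rungOfTallTilt_iff :
    Registered.stub_rungOfTallTilt ↔
      ∀ k : ℕ, 1 ≤ k → (∃ g : ℝ → ℝ, Monotone g ∧ (∀ s, 0 < s → 0 < g s) ∧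
        ∀ m L M : ℕ, 1 ≤ m → 2 * m ≤ L → L ≤ 5 * m → 2 * m ≤ M → M ≤ 5 * m → ∃ a : ℕ,
          g (blockP (criticalProbI 3) (4 * k * m) L M) ≤ tiltP (4 * k * m) L M m a) →
        SeedAt (2 * k) → SeedAt k :=
  Iff.rfl

/-- **The halving rung, DERIVED** (wave 1): `TallTilt → HalvingRung`, by the landed `stub_rungOfTallTilt`. -/
theorem halvingRung_of_tallTilt (hTilt : TallTilt) : HalvingRung := fun k hk h2k =>
  stub_rungOfTallTilt_iff.1 stub_rungOfTallTilt k hk (hTilt k hk) h2k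

/-! ## Proved plumbing -/

/-- Coordinatewise membership in the boxes `Icc 0 ![a, b, c]` of `ℤ³`. -/
theorem mem_Icc_iff {a b c : ℤ} {x : Site 3} : x ∈ Finset.Icc (0 : Site 3) ![a, b, c] ↔
    (0 ≤ x 0 ∧ 0 ≤ x 1 ∧ 0 ≤ x 2) ∧ (x 0 ≤ a ∧ x 1 ≤ b ∧ x 2 ≤ c) := by
  rw [Theorems.tilt_mem_Icc_iff]; simp

theorem blockP_nonneg (p : unitInterval) (h L M : ℕ) : 0 ≤ blockP p h L M := measureReal_nonneg

theorem blockP_le_one (p : unitInterval) (h L M : ℕ) : blockP p h L M ≤ 1 := measureReal_le_one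

/-- **Height monotonicity** (taller boxes over the same cross-section are easier to block), for
PROBABILITIES and every `p`: `h ≤ h' → β_p(h; L, M) ≤ β_p(h'; L, M)`. Proof: `P_p` is carried by
lattice configurations `ω ⊆ E(ℤ³)` (`DCT16.real_mono_of_forall_subset_edgeSet`); for such `ω` an open
path inside `R(h'; L, M)` from `x` (`x₀ = 0`) to `y` (`y₀ = h' ≥ h`) moves its height by at most one
per step, so it is clipped at its first visit `z` to the level `x₀ = h`
(`exists_openConnIn_le_level`), and the clipped path lies in `R(h'; L, M) ∩ {x₀ ≤ h} ⊆ R(h; L, M)`: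
the lower box is crossed. (The RAW events are not nested: a configuration containing the non-lattice
pair `s((0,0,0),(h',0,0))` crosses `R(h')` in one step without crossing `R(h)` — cf. `not_TiltGluing`.) -/
theorem blockP_mono_height (p : unitInterval) {h h' : ℕ} (hle : h ≤ h') (L M : ℕ) :
    blockP p h L M ≤ blockP p h' L M := by
  refine DCT16.real_mono_of_forall_subset_edgeSet (zdGraph 3) p fun ω hω hb => ?_
  rintro ⟨x, hx, y, hy, hx0, hy0, hxy⟩
  have hxR := mem_Icc_iff.1 hx
  have hyR := mem_Icc_iff.1 hy
  obtain ⟨z, hz, hr⟩ := exists_openConnIn_le_level (G := zdGraph 3) hω (fun w : Site 3 => w 0)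
    (fun u w huw => (zdGraph_adj_apply_le huw 0).1) (h : ℤ) (show x 0 ≤ (h : ℤ) by omega)
    (show (h : ℤ) ≤ y 0 by rw [hy0]; exact_mod_cast hle) hxy
  obtain ⟨hzS, hzh⟩ := hr.2.1
  have hzR := mem_Icc_iff.1 (Finset.mem_coe.1 hzS)
  have hzh' : z 0 ≤ (h : ℤ) := hzh
  refine hb ⟨x, mem_Icc_iff.2 ?_, z, mem_Icc_iff.2 ?_, hx0, hz, openConnIn_mono (fun w hw => ?_) x z hr⟩
  · omega
  · omega
  · obtain ⟨hw1, hw2⟩ := hw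
    have hwR := mem_Icc_iff.1 (Finset.mem_coe.1 hw1)
    have hw2' : w 0 ≤ (h : ℤ) := hw2
    exact Finset.mem_coe.2 (mem_Icc_iff.2 (by omega))

/-- Height monotonicity transports a seed UP the tall family: `k ≤ k' → SeedAt k → SeedAt k'`. -/
theorem SeedAt.mono {k k' : ℕ} (hkk' : k ≤ k') (hs : SeedAt k) : SeedAt k' := by
  obtain ⟨c, hc, hcle⟩ := hs
  exact ⟨c, hc, fun n hn =>
    (hcle n hn).trans (blockP_mono_height (criticalProbI 3) (Nat.mul_le_mul_right n hkk') n n)⟩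

/-- STUBS 1 and 2 are CONSEQUENCES of the crux (honest pieces; jointly equivalent to it). -/
theorem tallSeed_of (h : CubeBlockingSeed) : TallSeed := ⟨1, le_rfl, seedAt_one_iff.2 h⟩

theorem seedAt_of (h : CubeBlockingSeed) {k : ℕ} (hk : 1 ≤ k) : SeedAt k := (seedAt_one_iff.2 h).mono hk

theorem halvingRung_of (h : CubeBlockingSeed) : HalvingRung := fun _ hk _ => seedAt_of h hk

/-! ## The composition, by name -/

/-- Descent along the powers of two by the halving rung. -/
theorem seedAt_one_of_pow (hR : HalvingRung) : ∀ j : ℕ, SeedAt (2 ^ j) → SeedAt 1 := by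
  intro j
  induction j with
  | zero => intro h; simpa using h
  | succ j ih =>
    intro h
    rw [pow_succ'] at h
    exact ih (hR (2 ^ j) Nat.one_le_two_pow h)

/-- The LADDER: tall seed + halving rung ⟹ `SeedAt 1` (lift the seed from aspect `k₀` to `2^{k₀} ≥ k₀` by height
monotonicity, descend to aspect 1 by the rung). Stated with conclusion `SeedAt 1` (= the crux, `seedAt_one_iff`) so that
the only theorems of this file concluding the crux BY NAME are the two compositions below. -/
theorem seedAt_one_of_tallSeed_of_halvingRung (hT : TallSeed) (hR : HalvingRung) : SeedAt 1 := by
  obtain ⟨k, -, hs⟩ := hT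
  exact seedAt_one_of_pow hR k (hs.mono Nat.lt_two_pow_self.le)

/-- **STUB 3 `stub_ladder`** (S — LANDED p149603, `Theorems/PercTiltedBlockersCubeBlockingSeedLadder.lean`, lead):
the glue of the line in the registered spelling, `stub_tallSeed-text → HalvingRung-text → (the crux's body)`;
in-file twin: `seedAt_one_of_tallSeed_of_halvingRung`. -/
theorem stub_ladder :
    (∃ k : ℕ, 1 ≤ k ∧ ∃ c : ℝ, 0 < c ∧ ∀ n : ℕ, 1 ≤ n →
        c ≤ (bondPercolation (zdGraph 3) (criticalProbI 3)).real
            {ω | ¬ ∃ x ∈ Finset.Icc (0 : Site 3) ![((k * n : ℕ) : ℤ), n, n],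
              ∃ y ∈ Finset.Icc (0 : Site 3) ![((k * n : ℕ) : ℤ), n, n],
                x 0 = 0 ∧ y 0 = ((k * n : ℕ) : ℤ) ∧
                  ω ∈ openConnIn ↑(Finset.Icc (0 : Site 3) ![((k * n : ℕ) : ℤ), n, n]) x y}) →
      (∀ k : ℕ, 1 ≤ k →
        (∃ c : ℝ, 0 < c ∧ ∀ n : ℕ, 1 ≤ n →
          c ≤ (bondPercolation (zdGraph 3) (criticalProbI 3)).real
            {ω | ¬ ∃ x ∈ Finset.Icc (0 : Site 3) ![((2 * k * n : ℕ) : ℤ), n, n],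
              ∃ y ∈ Finset.Icc (0 : Site 3) ![((2 * k * n : ℕ) : ℤ), n, n],
                x 0 = 0 ∧ y 0 = ((2 * k * n : ℕ) : ℤ) ∧
                  ω ∈ openConnIn ↑(Finset.Icc (0 : Site 3) ![((2 * k * n : ℕ) : ℤ), n, n]) x y}) →
        ∃ c : ℝ, 0 < c ∧ ∀ n : ℕ, 1 ≤ n →
          c ≤ (bondPercolation (zdGraph 3) (criticalProbI 3)).real
            {ω | ¬ ∃ x ∈ Finset.Icc (0 : Site 3) ![((k * n : ℕ) : ℤ), n, n],
              ∃ y ∈ Finset.Icc (0 : Site 3) ![((k * n : ℕ) : ℤ), n, n],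
                x 0 = 0 ∧ y 0 = ((k * n : ℕ) : ℤ) ∧
                  ω ∈ openConnIn ↑(Finset.Icc (0 : Site 3) ![((k * n : ℕ) : ℤ), n, n]) x y}) →
      ∃ c : ℝ, 0 < c ∧ ∀ n : ℕ, 1 ≤ n → c ≤ (bondPercolation (zdGraph 3) (criticalProbI 3)).real
        {ω | ¬ ∃ x ∈ Finset.Icc (0 : Site 3) ![(n : ℤ), n, n], ∃ y ∈ Finset.Icc (0 : Site 3) ![(n : ℤ), n, n],
          x 0 = 0 ∧ y 0 = n ∧ ω ∈ openConnIn ↑(Finset.Icc (0 : Site 3) ![(n : ℤ), n, n]) x y} :=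
  Theorems.CubeBlockingSeed.stub_ladder

/-- **STUB 1⁻ `stub_tallSeedOfFlatAnnulusCrossing`** (M — LANDED p149647,
`Theorems/PercTiltedBlockersCubeBlockingSeedTallSeedOfFlatAnnulusCrossing.lean`, lead): the load-bearing stub is
IMPLIED by the sibling crux `Theses.PercDivergentSlabLadder.FlatAnnulusCrossing` (stmt-CriticalPhenomena-6699, "RSW for
flat washers at one aspect ratio, uniformly in thickness", OPEN): lay the tube `[0,(M+1)n]×[0,n]²` down into the washer
`{|z₀| ≤ n, R ≤ ρ ≤ 2R}`, `R = (M+1)n` — a lengthwise crossing of the tube is a radial crossing of the washer — then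
transpose `(0 1)` and translate back (`real_seal_perm_shift`). Hence `TallSeed` is at most as hard as 6699. -/
theorem stub_tallSeedOfFlatAnnulusCrossing :
    Summit.CriticalPhenomena.PercolationContinuityZ3.Theses.PercDivergentSlabLadder.FlatAnnulusCrossing →
      ∃ k : ℕ, 1 ≤ k ∧ ∃ c : ℝ, 0 < c ∧ ∀ n : ℕ, 1 ≤ n →
      c ≤ (bondPercolation (zdGraph 3) (criticalProbI 3)).real
          {ω | ¬ ∃ x ∈ Finset.Icc (0 : Site 3) ![((k * n : ℕ) : ℤ), n, n],
            ∃ y ∈ Finset.Icc (0 : Site 3) ![((k * n : ℕ) : ℤ), n, n],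
              x 0 = 0 ∧ y 0 = ((k * n : ℕ) : ℤ) ∧
                ω ∈ openConnIn ↑(Finset.Icc (0 : Site 3) ![((k * n : ℕ) : ℤ), n, n]) x y} :=
  Theorems.CubeBlockingSeed.stub_tallSeedOfFlatAnnulusCrossing

/-- `FlatAnnulusCrossing` (6699) gives the tube seed (readable form). -/
theorem tallSeed_of_flatAnnulusCrossing
    (h : Summit.CriticalPhenomena.PercolationContinuityZ3.Theses.PercDivergentSlabLadder.FlatAnnulusCrossing) :
    TallSeed :=
  stub_tallSeed_iff.1 (stub_tallSeedOfFlatAnnulusCrossing h)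

/-- **STUB 2′⁺ `stub_tallTiltOfWideSeeds`** (L — LANDED p150740 by the wave-2 stub-worker,
`Theorems/PercTiltedBlockersCubeBlockingSeedTallTiltOfWideSeeds.lean`): CONSISTENCY CERTIFICATE for STUB 2′ — flat wide seeds
`∃ c > 0, ∀ m ≥ 1, c ≤ β(4m; 24m, 24m)` (verbatim the conclusion of `Theses.PercTiltedBlockers.WideBoxFromTilt`) give `TallTilt`
with the CONSTANT `g ≡ min(c³, floor_k)`: a staircase of three seals (slab below `a`, slab above `a`, vertical slab in between,
`m < x₁ < L`) is a tilted blocker (`TallTiltOfWideSeeds.staircase`), Harris–FKG ×2, and a positivity floor for `m ≤ 29`.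
Corollary `Theorems.CubeBlockingSeed.tallTilt_of_tiltComparison_of_cubeBlockingSeed`: `TiltComparison (6393) → CubeBlockingSeed (1141) → TallTilt`
— STUB 2′ is not stronger than the route's two cruxes together (circular as a proof of the crux, of course). -/
theorem tallTilt_of_tiltComparison_of_cubeBlockingSeed
    (hT : Summit.CriticalPhenomena.PercolationContinuityZ3.Theses.PercTiltedBlockers.TiltComparison)
    (hS : CubeBlockingSeed) : TallTilt :=
  stub_tallTilt_iff.1 (Theorems.CubeBlockingSeed.tallTilt_of_tiltComparison_of_cubeBlockingSeed hT hS)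

/-- **Second entrance to the crux** (certified this cycle): the sibling crux `FlatAnnulusCrossing` (6699) and the tall
tilt comparison (STUB 2′) imply `SeedAt 1` (= the crux, `seedAt_one_iff`); stated with conclusion `SeedAt 1` so that
the by-name compositions below stay the only theorems concluding the crux decls. -/
theorem seedAt_one_of_flatAnnulusCrossing_of_tallTilt
    (h : Summit.CriticalPhenomena.PercolationContinuityZ3.Theses.PercDivergentSlabLadder.FlatAnnulusCrossing)
    (hTilt : TallTilt) : SeedAt 1 :=
  seedAt_one_of_tallSeed_of_halvingRung (tallSeed_of_flatAnnulusCrossing h) (halvingRung_of_tallTilt hTilt)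

/-- **`CubeBlockingSeed_of`** (r5): the two OPEN registered stubs imply the crux
`Summit.CriticalPhenomena.PercolationContinuityZ3.Theses.PercTiltedBlockers.CubeBlockingSeed`
(kernel-checked; no `sorry` outside `stub_tallSeed` / `stub_halvingRung`): the ladder. -/
theorem CubeBlockingSeed_of (hT : Registered.stub_tallSeed) (hR : Registered.stub_halvingRung) :
    Summit.CriticalPhenomena.PercolationContinuityZ3.Theses.PercTiltedBlockers.CubeBlockingSeed :=
  seedAt_one_iff.1 (seedAt_one_of_tallSeed_of_halvingRung (stub_tallSeed_iff.1 hT) (stub_halvingRung_iff.1 hR))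

/-- r4's composition survives as a corollary: tube seed + tall tilt comparison ⟹ the crux (the tilt comparison gives the rung). -/
theorem CubeBlockingSeed_of_tallTilt (hT : Registered.stub_tallSeed) (hTilt : Registered.stub_tallTilt) :
    Summit.CriticalPhenomena.PercolationContinuityZ3.Theses.PercTiltedBlockers.CubeBlockingSeed :=
  CubeBlockingSeed_of hT (stub_halvingRung_iff.2 (halvingRung_of_tallTilt (stub_tallTilt_iff.1 hTilt)))

/-- Third and fourth entrances (lead c1, landed): `FlatAnnulusCrossing (6699) ∧ HeightHalving12 ⟹ SeedAt 1` and the rung's consistency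
with `X_B`, read through this file's names. -/
theorem halvingRung_of_critAnnulusNonCrossing
    (h0846 : Summit.CriticalPhenomena.PercolationContinuityZ3.Theses.PercAnnulusCrossing.CritAnnulusNonCrossing) : HalvingRung :=
  stub_halvingRung_iff.1 (Theorems.CubeBlockingSeed.halvingRung_of_critAnnulusNonCrossing h0846)

theorem seedAt_one_of_flatAnnulusCrossing_of_halvingRung
    (h : Summit.CriticalPhenomena.PercolationContinuityZ3.Theses.PercDivergentSlabLadder.FlatAnnulusCrossing)
    (hR : HalvingRung) : SeedAt 1 :=
  seedAt_one_of_tallSeed_of_halvingRung (tallSeed_of_flatAnnulusCrossing h) hR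

/-- The item stmt-CriticalPhenomena-1141 is SHARED: its primary decl lives in route `PercAnnulusCrossing`
(rank 4) with the identical body, so the two route decls are definitionally the same statement. -/
theorem cubeBlockingSeed_shared_iff :
    Summit.CriticalPhenomena.PercolationContinuityZ3.Theses.PercAnnulusCrossing.CubeBlockingSeed ↔
      Summit.CriticalPhenomena.PercolationContinuityZ3.Theses.PercTiltedBlockers.CubeBlockingSeed :=
  Iff.rfl

/-- **`CubeBlockingSeedShared_of`**: the same registered stubs imply the item's primary decl
`Summit.CriticalPhenomena.PercolationContinuityZ3.Theses.PercAnnulusCrossing.CubeBlockingSeed`. -/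
theorem CubeBlockingSeedShared_of (hT : Registered.stub_tallSeed) (hR : Registered.stub_halvingRung) :
    Summit.CriticalPhenomena.PercolationContinuityZ3.Theses.PercAnnulusCrossing.CubeBlockingSeed :=
  cubeBlockingSeed_shared_iff.2 (CubeBlockingSeed_of hT hR)

/-- Wiring checks: the registered stubs feed both compositions as stated. -/
example : Summit.CriticalPhenomena.PercolationContinuityZ3.Theses.PercTiltedBlockers.CubeBlockingSeed :=
  CubeBlockingSeed_of stub_tallSeed stub_halvingRung

example : Summit.CriticalPhenomena.PercolationContinuityZ3.Theses.PercAnnulusCrossing.CubeBlockingSeed :=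
  CubeBlockingSeedShared_of stub_tallSeed stub_halvingRung

/-- The landed rung is what turns STUB 2′ into the halving rung inside `CubeBlockingSeed_of` (bookkeeping check). -/
example : Registered.stub_rungOfTallTilt := stub_rungOfTallTilt

end Summit.CriticalPhenomena.PercolationContinuityZ3.Cruxes.CubeBlockingSeed.Birth

end
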